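import Summits.QuantumFields.YangMills.Theorems.BalabanUVNodesN18CornerBandOfKernelLetters
import Literature.MathematicalPhysics.QuantumFieldTheory.Balaban1983to89.Node00.U3KernelLetters

/-!
# BalabanUVNodes ∕ N18 — THE CORNER KERNELS: N22's kernel NE9 gives the merged term's (1.21) kernels CORNER LIMITS `Π⁰_k(z) = lim_{t→0⁺} Π_{k+1}(t,…,t; z)` (v₀-free, with a
# linear band); N18's OWN LETTER `KernelStepRate` passes to the corners — `|Π⁰_k − Π⁰_{k+1}| ≤ C₅ θ^{k+1} e^{−κ|z|₁}` — so the corner kernels converge GEOMETRICALLY to a limit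
# kernel `Π⁰_∞`; at the β level FILE 1's corner NUMBERS are the second moments `Σ_z Π⁰_k(0,1,z) z₀z₁`, their step is `≤ C₅θ^{k+1}·betaPrime510 4 1 κ` and they converge
# geometrically to `secondMoment Π⁰_∞ 0 1` — the KERNEL ROAD (N18 + N22 + (5.10)) to the corner convergence that K2⁷'s corner road reads from N17 + an anchor; record editions
# (Track A, DAG node N18 = NE5; cluster K4 «SpineRates»; key K3⁷ `SpineGivenEndpointR13SepCoPH` = stmt-QuantumFields-20544, skeleton v5 941dddb108cbaacf; width seat `pub-ymgap-dag-n18-w1` g4,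
# FILE 3 of the g4 corner series — FILE 1 `…N18CornerBandOfKernelLetters` p612254, FILE 2 `…N18CornerBandOfKernelLettersRecord`)

HONEST FRAMING.  Count-neutral kernel bookkeeping BY NAME (`--kind proof --supports stmt-QuantumFields-20544 --as helper`).  Elementary real analysis (FILE 1's corner lemma applied
ENTRYWISE to the kernels; Mathlib's `cauchySeq_of_le_geometric` ∕ `dist_le_of_le_geometric_of_tendsto`; pv10∕t4's dominated summation `secondMoment_sub_abs_le`) composed with LANDED
lemmas of dag-n22-w3 (`decay510_kernelA_extd_sub_of_ne9`, `fadingMemory_histModuli_of_fadingMemory`) and def-W1's faces (`kernelA_congr`, `secondMoment_kernelA_extd`).  Kernel NE9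
(N22's input), `KernelStepRate` (N18's input — NE5 NOT PRINTED for d = 4) and the (5.10) clause ((D4)'s input) are DISPLAYED HYPOTHESES — nothing of Bałaban's is asserted, inhabited
or discharged; the corner kernels and the limit kernel are ∃-PRODUCED from those hypotheses (no `def`); NO value, sign or identification of `secondMoment Π⁰_∞ 0 1` is claimed (§2's
junction with def-B's `beta0OfTerms` is CONDITIONAL on a displayed kernel identity); N17 ∕ N18 ∕ N22 NOT discharged; K3⁷ OPEN (v5), `stub_rates13H` ∕ `stub_expansion13H` NOT proved;
K2⁷ served BY NAME only (the corner step ∕ convergence are idea-7's `CornerLimitSignSketch` §1 ∕ PORT-1's `…K2CornerRoad` §1 conclusions — there from N17 + an anchor, here from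
the kernel letters; cited, nothing re-declared).  Counts UNMOVED (typed 28∕28 · discharged 5∕27, A 5∕28).  One finite four-torus programme at fixed `ε`, Bałaban AS PRINTED; route R4
closes ONLY the conditional finite-𝕋⁴ rung `BalabanLadder.UV` — NOT the continuum limit, NOT ℝ⁴, NOT OS, NOT the Yang–Mills mass gap, NOT Clay.  THEOREMS ONLY: 0 `def`, 0 `instance`,
0 `sorry`, standard axioms.

WHY.  Under K3⁷ v5's node-U3 pin the N18 conjunct at the bundle of record COSTS EXACTLY W1-19b's letter `KernelStepRateOfRecord₁₃ F N θ ℓ.κ ℓ.θ₅ ℓ.C₅` (dag-n18-w1 g2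
`n18At_rateCarriers_of_kernels_pin_iff_letter`, p597580): `|Π_{k+1}(g; z) − Π_{k+2}(b, g; z)| ≤ C₅ θ₅^{k+1} e^{−κ|z|₁}` on `]0,θ.γ]^ℕ`.  FILES 1–2 of this series built the CORNER of
the U3 → U2 face from N22's letter alone (corner numbers of the β of record, v₀-free).  This file shows what N18's letter ALONE adds at the corner, in kernel currency: read along the
DIAGONAL `g = (t,t,…)`, `b = t` (the prepended sequence is the same diagonal) and passed to `t → 0⁺`, it is a GEOMETRIC STEP between consecutive corner kernels — so the coupling-free
(1.21) kernels of the merged term stabilise in `k` at the η-rate with an explicit limit kernel, and the corner numbers (= their (1.22) second moments) converge geometrically to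
`secondMoment Π⁰_∞ 0 1` — what is then owed about them is the VALUE ∕ SIGN of ONE number per record, or §2's displayed kernel identity.

WHAT (theorems only).  §1 generic term family (W1-19 `kernelA F ℰ ρ bV`): `extd_const` · `prependCoupling_const` · `const_mem_window` · ★ `histLipschitz_kernelEntry_of_ne9` (each kernel
ENTRY, as an `HBeta`-shaped function of the box history, is history-Lipschitz with moduli `e^{−κ|z|₁}·Λ (k+1) i`) · ★★ `exists_cornerKernels_of_ne9` (`0 < γ`, kernel NE9 ⟹ ∃ `Π⁰ : ℕ →
B12Beta.Kernel 4`: diagonal limits + band `|Π_{k+1}(extd v; z) − Π⁰_k(z)| ≤ e^{−κ|z|₁}·Σ_i |Λ (k+1) i|·v_i`) · `decay510_cornerKernel` · ★★ `abs_cornerKernel_step_le_of_kernelStepRate` (N18's letter ⟹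
corner step `≤ C₅ θ^{k+1} e^{−κ|z|₁}`) · ★★ `exists_limitKernel_of_cornerStep` (`θ < 1` ⟹ ∃ `Π⁰_∞` with `|Π⁰_k − Π⁰_∞| ≤ C₅ θ^{k+1} e^{−κ|z|₁}∕(1−θ)`) · `decay510_limitKernel`.  §2 β level:
`betaPrime510_eq_mul` · ★ `tendsto_betaMerged_diag_secondMoment_cornerKernel` · ★ `cornerNumber_eq_secondMoment_cornerKernel` (FILE 1's corner numbers ARE `secondMoment (Π⁰_k) 0 1`) · ★★
`abs_cornerMoment_step_le_of_kernelStepRate` (corner-number STEP `≤ C₅·θ^{k+1}·betaPrime510 4 1 κ`) · ★★ `abs_cornerMoment_sub_limitMoment_le` (geometric convergence to `secondMoment Π⁰_∞ 0 1`) ·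
`cornerNumber_eq_beta0OfTerms_of_cornerKernel_eq` (LOCATED junction: IF the corner kernels are the coupling-free family's limiting kernels `polLimit F (k+1) (ℰ0 k ·) ρ bV` — (2.13) «vanishes
at g_k = 0» read at the kernels, DISPLAYED — THEN the corner numbers are def-B's `beta0OfTerms F ℰ0 ρ bV`).  §3 AT THE RECORD (K3⁷ v5 §2b (i)'s `h9`, (iii)'s `hdec`, N18's letter of record
`KernelStepRateOfRecord₁₃ F N θ ℓ.κ ℓ.θ₅ ℓ.C₅`, `ℓ.Signs`, `0 < θ.γ`): ★★ `exists_cornerKernels_record_of_kernelNE9_kernelStepRate` (corner kernels of record: diagonal limits, k-UNIFORM band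
`e^{−ℓ.κ|z|₁}·ℓ.C₉ℓ.ω(1−ℓ.ω)⁻¹·θ.γ`, step at N18's rate, geometric limit kernel) · ★★ `cornerNumbers_record_geometric_of_kernelLetters` (corner numbers of `betaOfRecord₁₃ F N θ` as diagonal
limits, their step, their geometric convergence — v₀-free, anchor-free, κ-naming-free).

References (TYPES ∕ locators only): [Balaban1987RG1] CMP **109** (1987): Thm 1 p. 259 (NE5 NOT printed), (1.18) p. 263, (1.20)–(1.22) p. 264, (2.12)–(2.14) p. 268, §5 p. 298, (5.10) p. 293, (5.42) p. 297.
-/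

noncomputable section

open Filter Topology
open scoped BigOperators NNReal

namespace YMDAG.N18.CornerKernelsOfKernelLetters

open Literature.MathematicalPhysics.QuantumFieldTheory.Balaban1983to89
open Literature.MathematicalPhysics.QuantumFieldTheory.Balaban1983to89.T4Continuum (T4Family ULoop)
open Literature.MathematicalPhysics.QuantumFieldTheory.Balaban1983to89.T4OutputRate (Window NE9)
open Literature.MathematicalPhysics.QuantumFieldTheory.Balaban1983to89.FlowStep (Box HBeta mem_box)
open Literature.MathematicalPhysics.QuantumFieldTheory.Balaban1983to89.B12Beta (HistBox secondMoment)
open Literature.MathematicalPhysics.QuantumFieldTheory.Balaban1983to89.T4CouplingMatching (HistLipschitz FadingMemory)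
open Literature.MathematicalPhysics.QuantumFieldTheory.Balaban1983to89.T4FlagMemory (extd extd_coe)
open Literature.MathematicalPhysics.QuantumFieldTheory.Balaban1983to89.T4BetaReadOut (extd_mem_window)
open Literature.MathematicalPhysics.QuantumFieldTheory.Balaban1983to89.T4BetaReadOutLipschitz (secondMoment_sub_abs_le)
open Literature.MathematicalPhysics.QuantumFieldTheory.Balaban1983to89.Node00 (TermFamily0 TermFamily1 betaMerged beta0OfTerms polLimit prependCoupling
  mergedTermFamilyMatT TβOfRecord₁₃ TcanOfRecord chiβOfRecord₁₃ betaOfRecord₁₃ Stage13Params U3Letters₁₁)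
open Literature.MathematicalPhysics.QuantumFieldTheory.Balaban1983to89.Node00.U3OfKernels (kernelA EA objectsOfRecord₁₃ KernelDecay KernelDecayOfRecord₁₃
  kernelA_congr secondMoment_kernelA_extd)
open Literature.MathematicalPhysics.QuantumFieldTheory.Balaban1983to89.Node00.U3KernelLetters (KernelStepRate KernelStepRateOfRecord₁₃)
open Literature.MathematicalPhysics.QuantumFieldTheory.Balaban1983to89.B12Sec2to5 (l1 l1_nonneg Decay510 betaPrime510)
open YMDAG.N22.AtKernels (decay510_kernelA_extd_sub_of_ne9)
open YMDAG.N18.CornerBandOfKernelLetters (const_mem_box exists_cornerNumbers_of_histLipschitz abs_sub_le_sum_of_anchor_of_histLipschitz anchor_of_band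
  tendsto_diag_of_anchor_of_histLipschitz sum_abs_moduli_le_of_fadingMemory)

/-! ## §1 Generic term family: the CORNER KERNELS `Π⁰_k(z) = lim_{t→0⁺} Π_{k+1}(t,…,t; z)` from kernel NE9, their (5.10) class, N18's step rate passing to the corners,
their geometric convergence to a LIMIT KERNEL -/

section Kernels

variable {𝔄 : Type*} [NormedRing 𝔄] [NormedAlgebra ℝ 𝔄]
variable {V : Type*} [NormedAddCommGroup V] [NormedSpace ℝ V] {ι : Type*} [Fintype ι]
variable (F : T4Family) (ℰ : TermFamily1 F 𝔄) (ρ : V →L[ℝ] 𝔄) (bV : Module.Basis ι ℝ V)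

/-- Padding a DIAGONAL history gives the constant sequence. [folklore] -/
theorem extd_const {k : ℕ} (t : ℝ) : extd (fun _ : Fin (k + 1) => t) = fun _ : ℕ => t := by
  funext m
  unfold extd
  split <;> rfl

/-- The constant sequence prepended by its own value is itself. [folklore] -/
theorem prependCoupling_const (t : ℝ) : prependCoupling t (fun _ : ℕ => t) = fun _ : ℕ => t := by
  funext i
  cases i <;> rfl

/-- A constant sequence with value in `]0, γ]` lies in the window. [folklore] -/
theorem const_mem_window {γ t : ℝ} (ht : t ∈ Set.Ioc 0 γ) : (fun _ : ℕ => t) ∈ Window γ := fun _ => ht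

/-- ★ **KERNEL NE9 ⟹ EVERY KERNEL ENTRY, READ AS A FUNCTION OF THE BOX HISTORY, IS HISTORY-LIPSCHITZ** with moduli `e^{−κ|z|₁}·Λ (k+1) i` (node U3's shifted indexing):
the `HBeta`-shaped family `(k, v) ↦ Π_{k+1,μν}(extd v; z)` for fixed `(μ, ν, z)` (dag-n22-w3's `decay510_kernelA_extd_sub_of_ne9` read entrywise).  NE9 UNPRINTED — a binder.
[cite: Balaban1987RG1, (1.18) p.263, (1.20)-(1.21) p.264 and §5 p.298] -/
theorem histLipschitz_kernelEntry_of_ne9 {γ κ : ℝ} {Λ : ℕ → ℕ → ℝ} (h9 : NE9 (EA F ℰ ρ bV) (Window γ) κ Λ) (μ ν : Fin 4) (z : Fin 4 → ℤ) :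
    HistLipschitz (fun k i => Real.exp (-(κ * l1 z)) * Λ (k + 1) i) γ (fun k v => kernelA F ℰ ρ bV (extd v) k μ ν z) := by
  intro k p q hp hq
  have h := decay510_kernelA_extd_sub_of_ne9 F ℰ ρ bV h9 hp hq μ ν z
  refine h.trans (le_of_eq ?_)
  rw [Finset.sum_mul]
  refine Finset.sum_congr rfl fun i _ => ?_
  rw [neg_mul]
  ring

/-- ★★ **THE CORNER KERNELS FROM KERNEL NE9** (FILE 1's `exists_cornerNumbers_of_histLipschitz`, entry by entry): for `0 < γ` and `NE9 (EA F ℰ ρ bV) (Window γ) κ Λ` there are kernels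
`Π⁰_k : B12Beta.Kernel 4` — the limits of the DIAGONAL sections `t ↦ Π_{k+1,μν}(t,…,t; z)` as `t → 0⁺` — with the band
`|Π_{k+1,μν}(extd v; z) − Π⁰_k(μ,ν,z)| ≤ e^{−κ|z|₁}·Σ_i |Λ (k+1) i|·v_i` for every box history `v ∈ ]0, γ]^{k+1}`.  The kernel-level, v₀-FREE «coupling-free limit» of the merged
term's (1.21) kernels; an ∃-produced object, no `def`.  NE9 UNPRINTED — binder; nothing of Bałaban asserted. [cite: Balaban1987RG1, (1.20)-(1.21) p.264, (2.12)-(2.14) p.268 and §5 p.298] -/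
theorem exists_cornerKernels_of_ne9 {γ κ : ℝ} {Λ : ℕ → ℕ → ℝ} (hγ : 0 < γ) (h9 : NE9 (EA F ℰ ρ bV) (Window γ) κ Λ) :
    ∃ P0 : ℕ → B12Beta.Kernel 4,
      (∀ (k : ℕ) (μ ν : Fin 4) (z : Fin 4 → ℤ), Tendsto (fun t : ℝ => kernelA F ℰ ρ bV (fun _ : ℕ => t) k μ ν z) (𝓝[>] (0 : ℝ)) (𝓝 (P0 k μ ν z))) ∧
      ∀ (k : ℕ) (μ ν : Fin 4) (z : Fin 4 → ℤ) (v : Fin (k + 1) → ℝ), v ∈ Box γ k →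
        |kernelA F ℰ ρ bV (extd v) k μ ν z - P0 k μ ν z| ≤ Real.exp (-(κ * l1 z)) * ∑ i : Fin (k + 1), |Λ (k + 1) i| * v i := by
  have key := fun (μ ν : Fin 4) (z : Fin 4 → ℤ) => exists_cornerNumbers_of_histLipschitz hγ (histLipschitz_kernelEntry_of_ne9 F ℰ ρ bV h9 μ ν z)
  choose c hc using key
  refine ⟨fun k μ ν z => c μ ν z k, fun k μ ν z => ?_, fun k μ ν z v hv => ?_⟩
  · have h := (hc μ ν z).1 k
    simp only [extd_const] at h
    exact h
  · have h := (hc μ ν z).2 k v hv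
    refine h.trans (le_of_eq ?_)
    rw [Finset.mul_sum]
    refine Finset.sum_congr rfl fun i _ => ?_
    rw [abs_mul, abs_of_pos (Real.exp_pos _)]
    ring

/-- **THE CORNER KERNELS ARE (5.10)-CLASS**: from the (5.10) clause at the ONE constant sequence `γ` (`Decay510 (Π_{k+1,μν}(γ,γ,…)) C₀ κ`) and the band at the diagonal history `γ`,
`|Π⁰_k(μ,ν,z)| ≤ (C₀ + S_k γ)·e^{−κ|z|₁}`, `S_k := Σ_i |Λ (k+1) i|` (k-UNIFORM under fading memory, §1b). [cite: Balaban1987RG1, (5.10) p.293 and (1.20)-(1.21) p.264] -/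
theorem decay510_cornerKernel {γ κ : ℝ} {Λ : ℕ → ℕ → ℝ} (hγ : 0 < γ) {P0 : ℕ → B12Beta.Kernel 4}
    (hband : ∀ (k : ℕ) (μ ν : Fin 4) (z : Fin 4 → ℤ) (v : Fin (k + 1) → ℝ), v ∈ Box γ k →
      |kernelA F ℰ ρ bV (extd v) k μ ν z - P0 k μ ν z| ≤ Real.exp (-(κ * l1 z)) * ∑ i : Fin (k + 1), |Λ (k + 1) i| * v i)
    {k : ℕ} {μ ν : Fin 4} {C₀ : ℝ} (hdec : Decay510 (kernelA F ℰ ρ bV (fun _ : ℕ => γ) k μ ν) C₀ κ) :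
    Decay510 (P0 k μ ν) (C₀ + (∑ i : Fin (k + 1), |Λ (k + 1) i|) * γ) κ := by
  intro z
  have h1 := hdec z
  have h2 := hband k μ ν z (fun _ => γ) (const_mem_box ⟨hγ, le_rfl⟩)
  rw [extd_const, ← Finset.sum_mul] at h2
  have e : Real.exp (-κ * l1 z) = Real.exp (-(κ * l1 z)) := by rw [neg_mul]
  rw [e] at h1 ⊢
  calc |P0 k μ ν z| ≤ |kernelA F ℰ ρ bV (fun _ => γ) k μ ν z| + |kernelA F ℰ ρ bV (fun _ => γ) k μ ν z - P0 k μ ν z| := by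
        have := abs_sub_abs_le_abs_sub (kernelA F ℰ ρ bV (fun _ => γ) k μ ν z) (P0 k μ ν z)
        have := abs_sub_comm (kernelA F ℰ ρ bV (fun _ => γ) k μ ν z) (P0 k μ ν z)
        nlinarith [abs_nonneg (kernelA F ℰ ρ bV (fun _ => γ) k μ ν z - P0 k μ ν z), abs_abs (P0 k μ ν z),
          abs_sub_abs_le_abs_sub (P0 k μ ν z) (kernelA F ℰ ρ bV (fun _ => γ) k μ ν z)]
    _ ≤ C₀ * Real.exp (-(κ * l1 z)) + Real.exp (-(κ * l1 z)) * ((∑ i : Fin (k + 1), |Λ (k + 1) i|) * γ) := add_le_add h1 h2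
    _ = (C₀ + (∑ i : Fin (k + 1), |Λ (k + 1) i|) * γ) * Real.exp (-(κ * l1 z)) := by ring

/-- ★★ **N18's LETTER PASSES TO THE CORNERS** (the kernel road; nothing of N17 used): `KernelStepRate F ℰ ρ bV γ κ θ C₅` — `|Π_{k+1}(g; z) − Π_{k+2}(b, g; z)| ≤ C₅ θ^{k+1} e^{−κ|z|₁}`
for `b ∈ ]0,γ]`, `g ∈ ]0,γ]^ℕ` — read along the DIAGONAL `g = (t,t,…)`, `b = t` (the prepended sequence is the same diagonal) and passed to the limit `t → 0⁺` gives the CORNER STEP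
`|Π⁰_k(z) − Π⁰_{k+1}(z)| ≤ C₅ θ^{k+1} e^{−κ|z|₁}`.  NE5 NOT PRINTED for d = 4 — binder; N18 NOT discharged. [cite: Balaban1987RG1, Thm 1 p.259 and (1.20)-(1.22) p.264] -/
theorem abs_cornerKernel_step_le_of_kernelStepRate {γ κ θ C₅ : ℝ} (hγ : 0 < γ) (h18 : KernelStepRate F ℰ ρ bV γ κ θ C₅) {P0 : ℕ → B12Beta.Kernel 4}
    (hP : ∀ (k : ℕ) (μ ν : Fin 4) (z : Fin 4 → ℤ), Tendsto (fun t : ℝ => kernelA F ℰ ρ bV (fun _ : ℕ => t) k μ ν z) (𝓝[>] (0 : ℝ)) (𝓝 (P0 k μ ν z)))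
    (k : ℕ) (μ ν : Fin 4) (z : Fin 4 → ℤ) : |P0 k μ ν z - P0 (k + 1) μ ν z| ≤ C₅ * θ ^ (k + 1) * Real.exp (-(κ * l1 z)) := by
  have hev : ∀ᶠ t in 𝓝[>] (0 : ℝ), |kernelA F ℰ ρ bV (fun _ : ℕ => t) k μ ν z - kernelA F ℰ ρ bV (fun _ : ℕ => t) (k + 1) μ ν z| ≤
      C₅ * θ ^ (k + 1) * Real.exp (-(κ * l1 z)) := by
    filter_upwards [Ioc_mem_nhdsGT hγ] with t ht
    have h := h18 t ht.1 ht.2 (fun _ => t) (const_mem_window ht) k μ ν z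
    rwa [prependCoupling_const] at h
  exact le_of_tendsto (((hP k μ ν z).sub (hP (k + 1) μ ν z)).abs) hev

/-- ★★ **GEOMETRIC CONVERGENCE OF THE CORNER KERNELS TO A LIMIT KERNEL** (`0 ≤ θ < 1`; ℝ complete, Mathlib's `cauchySeq_of_le_geometric`): from the corner step, a kernel `Π⁰_∞` with
`Π⁰_k(μ,ν,z) → Π⁰_∞(μ,ν,z)` and `|Π⁰_k(μ,ν,z) − Π⁰_∞(μ,ν,z)| ≤ C₅ θ^{k+1} e^{−κ|z|₁} ∕ (1 − θ)` for every `k` — in print's words the `k → ∞` stabilisation of the coupling-free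
vacuum-polarisation kernels at the η-rate; here a CONSEQUENCE of the displayed step, nothing asserted. [cite: Balaban1987RG1, Thm 1 p.259 and (1.20)-(1.22) p.264] -/
theorem exists_limitKernel_of_cornerStep {κ θ C₅ : ℝ} (hθ1 : θ < 1) {P0 : ℕ → B12Beta.Kernel 4}
    (hstep : ∀ (k : ℕ) (μ ν : Fin 4) (z : Fin 4 → ℤ), |P0 k μ ν z - P0 (k + 1) μ ν z| ≤ C₅ * θ ^ (k + 1) * Real.exp (-(κ * l1 z))) :
    ∃ Pinf : B12Beta.Kernel 4, ∀ (μ ν : Fin 4) (z : Fin 4 → ℤ),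
      Tendsto (fun k : ℕ => P0 k μ ν z) atTop (𝓝 (Pinf μ ν z)) ∧
        ∀ k : ℕ, |P0 k μ ν z - Pinf μ ν z| ≤ C₅ * θ ^ (k + 1) * Real.exp (-(κ * l1 z)) / (1 - θ) := by
  have hu : ∀ (μ ν : Fin 4) (z : Fin 4 → ℤ) (n : ℕ), dist (P0 n μ ν z) (P0 (n + 1) μ ν z) ≤ (C₅ * θ * Real.exp (-(κ * l1 z))) * θ ^ n :=
    fun μ ν z n => by
      rw [Real.dist_eq]
      refine (hstep n μ ν z).trans (le_of_eq ?_)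
      ring
  have hlim := fun (μ ν : Fin 4) (z : Fin 4 → ℤ) => cauchySeq_tendsto_of_complete (cauchySeq_of_le_geometric θ _ hθ1 (hu μ ν z))
  choose L hL using hlim
  refine ⟨fun μ ν z => L μ ν z, fun μ ν z => ⟨hL μ ν z, fun k => ?_⟩⟩
  have h := dist_le_of_le_geometric_of_tendsto θ _ hθ1 (hu μ ν z) (hL μ ν z) k
  rw [Real.dist_eq] at h
  refine h.trans (le_of_eq ?_)
  ring

/-- The limit kernel is (5.10)-class (constant `C + C₅θ∕(1−θ)` from the corner kernels' constant `C` at `k = 0` and the rate). [cite: Balaban1987RG1, (5.10) p.293] -/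
theorem decay510_limitKernel {κ θ C₅ C : ℝ} {P0 : ℕ → B12Beta.Kernel 4} {Pinf : B12Beta.Kernel 4} {μ ν : Fin 4}
    (h0 : Decay510 (P0 0 μ ν) C κ) (hrate : ∀ (k : ℕ) (z : Fin 4 → ℤ), |P0 k μ ν z - Pinf μ ν z| ≤ C₅ * θ ^ (k + 1) * Real.exp (-(κ * l1 z)) / (1 - θ)) :
    Decay510 (Pinf μ ν) (C + C₅ * θ / (1 - θ)) κ := by
  intro z
  have h1 := h0 z
  have h2 := hrate 0 z
  have e : Real.exp (-κ * l1 z) = Real.exp (-(κ * l1 z)) := by rw [neg_mul]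
  rw [e] at h1 ⊢
  rw [zero_add, pow_one] at h2
  calc |Pinf μ ν z| ≤ |P0 0 μ ν z| + |P0 0 μ ν z - Pinf μ ν z| := by
        have := abs_sub_abs_le_abs_sub (Pinf μ ν z) (P0 0 μ ν z)
        rw [abs_sub_comm] at this
        linarith
    _ ≤ C * Real.exp (-(κ * l1 z)) + C₅ * θ * Real.exp (-(κ * l1 z)) / (1 - θ) := add_le_add h1 h2
    _ = (C + C₅ * θ / (1 - θ)) * Real.exp (-(κ * l1 z)) := by ring

end Kernels

/-! ## §2 The β level: FILE 1's corner NUMBERS are the second moments of the corner kernels; N18's letter gives the corner-number step and their geometric limit —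
the kernel road to what idea-7 ∕ PORT-1 obtain from N17 + an anchor -/

section Beta

variable {𝔄 : Type*} [NormedRing 𝔄] [NormedAlgebra ℝ 𝔄]
variable {V : Type*} [NormedAddCommGroup V] [NormedSpace ℝ V] {ι : Type*} [Fintype ι]
variable (F : T4Family) (ℰ : TermFamily1 F 𝔄) (ρ : V →L[ℝ] 𝔄) (bV : Module.Basis ι ℝ V)

/-- `betaPrime510 4 C κ = C · betaPrime510 4 1 κ`. [cite: Balaban1987RG1, (5.10) p.293 (bookkeeping)] -/
theorem betaPrime510_eq_mul (C κ : ℝ) : betaPrime510 4 C κ = C * betaPrime510 4 1 κ := by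
  unfold betaPrime510
  rw [one_mul]

/-- ★ **THE DIAGONAL β CONVERGES TO THE SECOND MOMENT OF THE CORNER KERNEL** (`0 < κ`; (5.10) of the run-A kernels ON THE WINDOW for dominated summation, pv10∕t4's
`secondMoment_sub_abs_le`): `betaMerged … k (t,…,t) → secondMoment (Π⁰_k) 0 1` as `t → 0⁺` — since `|Π_{k+1}(t,…,t; ·) − Π⁰_k| ≤ S_k·t·e^{−κ|·|₁}` is a (5.10)-class kernel with constant
`S_k t → 0`. [cite: Balaban1987RG1, (1.22) p.264 and (5.10) p.293, (5.42) p.297] -/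
theorem tendsto_betaMerged_diag_secondMoment_cornerKernel {γ κ : ℝ} {Λ : ℕ → ℕ → ℝ} (hγ : 0 < γ) (hκ : 0 < κ)
    (hdec : KernelDecay F ℰ ρ bV (Window γ) 0 1 κ) {P0 : ℕ → B12Beta.Kernel 4}
    (hband : ∀ (k : ℕ) (μ ν : Fin 4) (z : Fin 4 → ℤ) (v : Fin (k + 1) → ℝ), v ∈ Box γ k →
      |kernelA F ℰ ρ bV (extd v) k μ ν z - P0 k μ ν z| ≤ Real.exp (-(κ * l1 z)) * ∑ i : Fin (k + 1), |Λ (k + 1) i| * v i) (k : ℕ) :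
    Tendsto (fun t : ℝ => betaMerged F ℰ ρ bV k (fun _ : Fin (k + 1) => t)) (𝓝[>] (0 : ℝ)) (𝓝 (secondMoment (P0 k) 0 1)) := by
  set S : ℝ := ∑ i : Fin (k + 1), |Λ (k + 1) i| with hS
  obtain ⟨C₀, hC₀⟩ := hdec (fun _ => γ) (const_mem_window ⟨hγ, le_rfl⟩)
  have hPdec : Decay510 (P0 k 0 1) (C₀ + S * γ) κ := decay510_cornerKernel F ℰ ρ bV hγ hband (hC₀ k)
  have key : ∀ᶠ t in 𝓝[>] (0 : ℝ), ‖betaMerged F ℰ ρ bV k (fun _ : Fin (k + 1) => t) - secondMoment (P0 k) 0 1‖ ≤ betaPrime510 4 1 κ * S * t := by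
    filter_upwards [Ioc_mem_nhdsGT hγ] with t ht
    obtain ⟨Ct, hCt⟩ := hdec (fun _ => t) (const_mem_window ht)
    have hA : Decay510 (kernelA F ℰ ρ bV (extd (fun _ : Fin (k + 1) => t)) k 0 1) Ct κ := by rw [extd_const]; exact hCt k
    have hD : Decay510 (fun z => kernelA F ℰ ρ bV (extd (fun _ : Fin (k + 1) => t)) k 0 1 z - P0 k 0 1 z) (S * t) κ := by
      intro z
      have h := hband k 0 1 z (fun _ => t) (const_mem_box ht)
      rw [← Finset.sum_mul] at h
      rw [neg_mul]
      refine h.trans (le_of_eq ?_)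
      ring
    have h := secondMoment_sub_abs_le (Pk := kernelA F ℰ ρ bV (extd (fun _ : Fin (k + 1) => t)) k) (Pk' := P0 k) hκ hA hPdec hD
    rw [secondMoment_kernelA_extd, betaPrime510_eq_mul] at h
    rw [Real.norm_eq_abs]
    refine h.trans (le_of_eq ?_)
    ring
  have h0 : Tendsto (fun t : ℝ => betaPrime510 4 1 κ * S * t) (𝓝[>] (0 : ℝ)) (𝓝 0) := by
    have h : Tendsto (fun t : ℝ => betaPrime510 4 1 κ * S * t) (𝓝 (0 : ℝ)) (𝓝 (betaPrime510 4 1 κ * S * 0)) :=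
      (continuous_const.mul continuous_id).tendsto 0
    rw [mul_zero] at h
    exact h.mono_left nhdsWithin_le_nhds
  exact tendsto_sub_nhds_zero_iff.1 (squeeze_zero_norm' key h0)

/-- ★ **FILE 1's CORNER NUMBERS ARE THE SECOND MOMENTS OF THE CORNER KERNELS** (uniqueness of limits along `𝓝[>] 0`): if `betaMerged … k (t,…,t) → b_k` (the diagonal reading of
FILE 1 ∕ FILE 2's corner numbers) then `b_k = Σ_z Π⁰_k(0,1,z) z₀ z₁` — the (1.22) recipe AT the corner. [cite: Balaban1987RG1, (1.22) p.264] -/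
theorem cornerNumber_eq_secondMoment_cornerKernel {γ κ : ℝ} {Λ : ℕ → ℕ → ℝ} (hγ : 0 < γ) (hκ : 0 < κ)
    (hdec : KernelDecay F ℰ ρ bV (Window γ) 0 1 κ) {P0 : ℕ → B12Beta.Kernel 4}
    (hband : ∀ (k : ℕ) (μ ν : Fin 4) (z : Fin 4 → ℤ) (v : Fin (k + 1) → ℝ), v ∈ Box γ k →
      |kernelA F ℰ ρ bV (extd v) k μ ν z - P0 k μ ν z| ≤ Real.exp (-(κ * l1 z)) * ∑ i : Fin (k + 1), |Λ (k + 1) i| * v i)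
    {b : ℕ → ℝ} (hb : ∀ k : ℕ, Tendsto (fun t : ℝ => betaMerged F ℰ ρ bV k (fun _ : Fin (k + 1) => t)) (𝓝[>] (0 : ℝ)) (𝓝 (b k))) (k : ℕ) :
    b k = secondMoment (P0 k) 0 1 :=
  tendsto_nhds_unique (hb k) (tendsto_betaMerged_diag_secondMoment_cornerKernel F ℰ ρ bV hγ hκ hdec hband k)

/-- ★★ **THE CORNER-NUMBER STEP FROM N18's LETTER, BY THE KERNEL ROAD**: with kernel NE9 (for the corner kernels), (5.10) on the window and `KernelStepRate F ℰ ρ bV γ κ θ C₅`, the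
second moments `c_k := secondMoment (Π⁰_k) 0 1` of the corner kernels (= the corner numbers, previous theorem) satisfy `|c_k − c_{k+1}| ≤ C₅·θ^{k+1}·betaPrime510 4 1 κ` — the
per-scale CORNER STEP that idea-7 ∕ PORT-1 obtain from N17's `ScaleShiftRate` + an anchor (`…K2CornerRoad` §1), here directly from N18's and N22's kernel letters with Bałaban-currency
constants.  LOCATED: all three letters displayed. [cite: Balaban1987RG1, Thm 1 p.259, (1.22) p.264 and (5.10) p.293] -/
theorem abs_cornerMoment_step_le_of_kernelStepRate {γ κ θ C₅ : ℝ} {Λ : ℕ → ℕ → ℝ} (hγ : 0 < γ) (hκ : 0 < κ)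
    (hdec : KernelDecay F ℰ ρ bV (Window γ) 0 1 κ) (h18 : KernelStepRate F ℰ ρ bV γ κ θ C₅) {P0 : ℕ → B12Beta.Kernel 4}
    (hP : ∀ (k : ℕ) (μ ν : Fin 4) (z : Fin 4 → ℤ), Tendsto (fun t : ℝ => kernelA F ℰ ρ bV (fun _ : ℕ => t) k μ ν z) (𝓝[>] (0 : ℝ)) (𝓝 (P0 k μ ν z)))
    (hband : ∀ (k : ℕ) (μ ν : Fin 4) (z : Fin 4 → ℤ) (v : Fin (k + 1) → ℝ), v ∈ Box γ k →
      |kernelA F ℰ ρ bV (extd v) k μ ν z - P0 k μ ν z| ≤ Real.exp (-(κ * l1 z)) * ∑ i : Fin (k + 1), |Λ (k + 1) i| * v i) (k : ℕ) :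
    |secondMoment (P0 k) 0 1 - secondMoment (P0 (k + 1)) 0 1| ≤ C₅ * θ ^ (k + 1) * betaPrime510 4 1 κ := by
  obtain ⟨C₀, hC₀⟩ := hdec (fun _ => γ) (const_mem_window ⟨hγ, le_rfl⟩)
  have hk : Decay510 (P0 k 0 1) _ κ := decay510_cornerKernel F ℰ ρ bV hγ hband (hC₀ k)
  have hk1 : Decay510 (P0 (k + 1) 0 1) _ κ := decay510_cornerKernel F ℰ ρ bV hγ hband (hC₀ (k + 1))
  have hD : Decay510 (fun z => P0 k 0 1 z - P0 (k + 1) 0 1 z) (C₅ * θ ^ (k + 1)) κ := by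
    intro z
    rw [neg_mul]
    exact abs_cornerKernel_step_le_of_kernelStepRate F ℰ ρ bV hγ h18 hP k 0 1 z
  have h := secondMoment_sub_abs_le (Pk := P0 k) (Pk' := P0 (k + 1)) hκ hk hk1 hD
  rwa [betaPrime510_eq_mul] at h

/-- ★★ **THE CORNER NUMBERS CONVERGE GEOMETRICALLY TO THE SECOND MOMENT OF THE LIMIT KERNEL** — from N18's corner step and the limit kernel of §1:
`|secondMoment (Π⁰_k) 0 1 − secondMoment (Π⁰_∞) 0 1| ≤ (C₅ θ^{k+1}∕(1−θ))·betaPrime510 4 1 κ`.  So under N18 + N22 + (5.10) the corner numbers of the merged β form a Cauchy sequence at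
the η-rate with an EXPLICIT limit object — the kernel-currency companion of `…K2CornerRoad`'s «N17 + anchor ⟹ geometric convergence»; what remains for an (AF)∕(D1) desk is the VALUE ∕ SIGN
of `secondMoment Π⁰_∞ 0 1`, not its existence.  LOCATED; nothing of Bałaban asserted. [cite: Balaban1987RG1, Thm 1 p.259, (1.22) p.264, (2.12)-(2.14) p.268 and (5.10) p.293] -/
theorem abs_cornerMoment_sub_limitMoment_le {γ κ θ C₅ : ℝ} {Λ : ℕ → ℕ → ℝ} (hγ : 0 < γ) (hκ : 0 < κ)
    (hdec : KernelDecay F ℰ ρ bV (Window γ) 0 1 κ) {P0 : ℕ → B12Beta.Kernel 4} {Pinf : B12Beta.Kernel 4}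
    (hband : ∀ (k : ℕ) (μ ν : Fin 4) (z : Fin 4 → ℤ) (v : Fin (k + 1) → ℝ), v ∈ Box γ k →
      |kernelA F ℰ ρ bV (extd v) k μ ν z - P0 k μ ν z| ≤ Real.exp (-(κ * l1 z)) * ∑ i : Fin (k + 1), |Λ (k + 1) i| * v i)
    (hrate : ∀ (k : ℕ) (z : Fin 4 → ℤ), |P0 k 0 1 z - Pinf 0 1 z| ≤ C₅ * θ ^ (k + 1) * Real.exp (-(κ * l1 z)) / (1 - θ)) (k : ℕ) :
    |secondMoment (P0 k) 0 1 - secondMoment Pinf 0 1| ≤ C₅ * θ ^ (k + 1) / (1 - θ) * betaPrime510 4 1 κ := by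
  obtain ⟨C₀, hC₀⟩ := hdec (fun _ => γ) (const_mem_window ⟨hγ, le_rfl⟩)
  have hk : Decay510 (P0 k 0 1) _ κ := decay510_cornerKernel F ℰ ρ bV hγ hband (hC₀ k)
  have h0 : Decay510 (P0 0 0 1) _ κ := decay510_cornerKernel F ℰ ρ bV hγ hband (hC₀ 0)
  have hinf : Decay510 (Pinf 0 1) _ κ := decay510_limitKernel h0 hrate
  have hD : Decay510 (fun z => P0 k 0 1 z - Pinf 0 1 z) (C₅ * θ ^ (k + 1) / (1 - θ)) κ := by
    intro z
    rw [neg_mul]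
    refine (hrate k z).trans (le_of_eq ?_)
    ring
  have h := secondMoment_sub_abs_le (Pk := P0 k) (Pk' := Pinf) hκ hk hinf hD
  rwa [betaPrime510_eq_mul] at h

/-- **THE HONEST HOME OF THE IDENTIFICATION** (located junction, kernel currency): def-B's coupling-free one-loop numbers are `beta0OfTerms F ℰ0 ρ bV k = secondMoment (polLimit F (k+1)
(ℰ0 k ·) ρ bV) 0 1` (`Node00/BetaOfRecord`).  Hence IF the merged family's CORNER KERNELS are the coupling-free family's limiting kernels — `Π⁰_k = polLimit F (k+1) (fun K => ℰ0 k K) ρ bV`,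
print's (2.13) «the remainder vanishes at `g_k = 0`» READ AT THE KERNELS (a DISPLAYED hypothesis; NOT proved here, NOT asserted) — then the corner numbers ARE `beta0OfTerms F ℰ0 ρ bV`.
So the (D1)-type identification of the corner numbers with named one-loop numbers splits into (i) this kernel statement about the two term families and (ii) the evaluation of def-B's
`beta0OfTerms` — neither claimed. [cite: Balaban1987RG1, (1.3)-(1.4) p.260, (2.12)-(2.13) p.268 and (1.22) p.264] -/
theorem cornerNumber_eq_beta0OfTerms_of_cornerKernel_eq {γ κ : ℝ} {Λ : ℕ → ℕ → ℝ} (hγ : 0 < γ) (hκ : 0 < κ)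
    (hdec : KernelDecay F ℰ ρ bV (Window γ) 0 1 κ) {P0 : ℕ → B12Beta.Kernel 4}
    (hband : ∀ (k : ℕ) (μ ν : Fin 4) (z : Fin 4 → ℤ) (v : Fin (k + 1) → ℝ), v ∈ Box γ k →
      |kernelA F ℰ ρ bV (extd v) k μ ν z - P0 k μ ν z| ≤ Real.exp (-(κ * l1 z)) * ∑ i : Fin (k + 1), |Λ (k + 1) i| * v i)
    {b : ℕ → ℝ} (hb : ∀ k : ℕ, Tendsto (fun t : ℝ => betaMerged F ℰ ρ bV k (fun _ : Fin (k + 1) => t)) (𝓝[>] (0 : ℝ)) (𝓝 (b k)))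
    (ℰ0 : TermFamily0 F 𝔄) (hcf : ∀ k : ℕ, P0 k = polLimit F (k + 1) (fun K => ℰ0 k K) ρ bV) (k : ℕ) :
    b k = beta0OfTerms F ℰ0 ρ bV k := by
  rw [cornerNumber_eq_secondMoment_cornerKernel F ℰ ρ bV hγ hκ hdec hband hb k, hcf k]
  rfl

end Beta

/-! ## §3 At the record, Stage 13: the corner kernels of the merged term family OF RECORD from K3⁷ v5 §2b (i)'s `h9`; N18's letter of record `KernelStepRateOfRecord₁₃` drives them -/

section Record

open scoped Matrix.Norms.L2Operator

variable (F : T4Family) (N : ℕ) [NeZero N]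

/-- ★★ **THE CORNER KERNELS OF RECORD AND N18's LETTER OF RECORD** (K3⁷ v5 pin currency): for a Stage-13 `θ` with `0 < θ.γ`, a letter block `ℓ` with `ℓ.Signs`, kernel NE9 of the
functional of record `(objectsOfRecord₁₃ F N θ ℓ).EA 0` on `]0,θ.γ]^ℕ` at `(ℓ.κ, ℓ.moduli)` (§2b (i)'s `h9` VERBATIM) and N18's letter `KernelStepRateOfRecord₁₃ F N θ ℓ.κ ℓ.θ₅ ℓ.C₅`
(dag-n18-w1 g2's `n18At_rateCarriers_of_kernels_pin_iff_letter`: EXACTLY the N18 conjunct under the pin): corner kernels `Π⁰_k` of the merged (1.21) kernels of record exist (diagonal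
limits, band with k-UNIFORM total modulus `ℓ.C₉·ℓ.ω·(1−ℓ.ω)⁻¹`), step at N18's rate `ℓ.C₅·ℓ.θ₅^{k+1}·e^{−ℓ.κ|z|₁}`, and converge geometrically to a limit kernel `Π⁰_∞`.  LOCATED: both
letters displayed, inhabited at no θ here; N18 ∕ N22 NOT discharged; `stub_rates13H` NOT proved. [cite: Balaban1987RG1, Thm 1 p.259, (1.20)-(1.22) p.264 and §5 p.298] -/
theorem exists_cornerKernels_record_of_kernelNE9_kernelStepRate (θ : Stage13Params F N) (ℓ : U3Letters₁₁) (hs : ℓ.Signs) (hγ : 0 < θ.γ)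
    (h9 : NE9 ((objectsOfRecord₁₃ F N θ ℓ).EA 0) (Window θ.γ) ℓ.κ ℓ.moduli) (h18 : KernelStepRateOfRecord₁₃ F N θ ℓ.κ ℓ.θ₅ ℓ.C₅) :
    letI := θ.instVβ₁; letI := θ.instVβ₂; letI := θ.instιβ
    ∃ (P0 : ℕ → B12Beta.Kernel 4) (Pinf : B12Beta.Kernel 4),
      (∀ (k : ℕ) (μ ν : Fin 4) (z : Fin 4 → ℤ),
        Tendsto (fun t : ℝ => kernelA F (mergedTermFamilyMatT F N (TβOfRecord₁₃ F N) (chiβOfRecord₁₃ F N θ) θ.εbg) θ.ρ8 θ.bV (fun _ : ℕ => t) k μ ν z)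
          (𝓝[>] (0 : ℝ)) (𝓝 (P0 k μ ν z))) ∧
      (∀ (k : ℕ) (μ ν : Fin 4) (z : Fin 4 → ℤ) (v : Fin (k + 1) → ℝ), v ∈ Box θ.γ k →
        |kernelA F (mergedTermFamilyMatT F N (TβOfRecord₁₃ F N) (chiβOfRecord₁₃ F N θ) θ.εbg) θ.ρ8 θ.bV (extd v) k μ ν z - P0 k μ ν z| ≤
          Real.exp (-(ℓ.κ * l1 z)) * (ℓ.C₉ * ℓ.ω * (1 - ℓ.ω)⁻¹) * θ.γ) ∧
      (∀ (k : ℕ) (μ ν : Fin 4) (z : Fin 4 → ℤ), |P0 k μ ν z - P0 (k + 1) μ ν z| ≤ ℓ.C₅ * ℓ.θ₅ ^ (k + 1) * Real.exp (-(ℓ.κ * l1 z))) ∧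
      ∀ (μ ν : Fin 4) (z : Fin 4 → ℤ), Tendsto (fun k : ℕ => P0 k μ ν z) atTop (𝓝 (Pinf μ ν z)) ∧
        ∀ k : ℕ, |P0 k μ ν z - Pinf μ ν z| ≤ ℓ.C₅ * ℓ.θ₅ ^ (k + 1) * Real.exp (-(ℓ.κ * l1 z)) / (1 - ℓ.θ₅) := by
  letI := θ.instVβ₁; letI := θ.instVβ₂; letI := θ.instιβ
  obtain ⟨P0, hT, hband⟩ := exists_cornerKernels_of_ne9 F _ θ.ρ8 θ.bV hγ h9
  have hstep := abs_cornerKernel_step_le_of_kernelStepRate F _ θ.ρ8 θ.bV hγ h18 hT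
  obtain ⟨Pinf, hinf⟩ := exists_limitKernel_of_cornerStep hs.θ₅_lt_one hstep
  refine ⟨P0, Pinf, hT, fun k μ ν z v hv => ?_, hstep, hinf⟩
  -- the k-uniform total modulus: `Σ_i |ℓ.moduli (k+1) i|·v_i ≤ (C₉ ω (1−ω)⁻¹)·θ.γ` (fading memory at the shifted index, entries ≤ θ.γ)
  have hF : FadingMemory (ℓ.C₉ * ℓ.ω) ℓ.ω (fun k i => ℓ.moduli (k + 1) i) := by
    have h := YMDAG.N22.AtKernels.fadingMemory_histModuli_of_fadingMemory (M := 1) (Λ := ℓ.moduli) zero_le_one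
      (fun a i _ => ⟨hs.moduli_nonneg a i, le_rfl⟩)
    simpa only [one_mul] using h
  refine (hband k μ ν z v hv).trans ?_
  have hsum : ∑ i : Fin (k + 1), |ℓ.moduli (k + 1) i| * v i ≤ (ℓ.C₉ * ℓ.ω * (1 - ℓ.ω)⁻¹) * θ.γ := by
    calc ∑ i : Fin (k + 1), |ℓ.moduli (k + 1) i| * v i ≤ ∑ i : Fin (k + 1), |ℓ.moduli (k + 1) i| * θ.γ :=
          Finset.sum_le_sum fun i _ => mul_le_mul_of_nonneg_left ((mem_box.1 hv) i).2 (abs_nonneg _)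
      _ = (∑ i : Fin (k + 1), |ℓ.moduli (k + 1) i|) * θ.γ := by rw [Finset.sum_mul]
      _ ≤ (ℓ.C₉ * ℓ.ω * (1 - ℓ.ω)⁻¹) * θ.γ :=
          mul_le_mul_of_nonneg_right (sum_abs_moduli_le_of_fadingMemory hF hs.ω_nonneg hs.ω_lt_one k) hγ.le
  calc Real.exp (-(ℓ.κ * l1 z)) * ∑ i : Fin (k + 1), |ℓ.moduli (k + 1) i| * v i
      ≤ Real.exp (-(ℓ.κ * l1 z)) * ((ℓ.C₉ * ℓ.ω * (1 - ℓ.ω)⁻¹) * θ.γ) := mul_le_mul_of_nonneg_left hsum (Real.exp_nonneg _)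
    _ = Real.exp (-(ℓ.κ * l1 z)) * (ℓ.C₉ * ℓ.ω * (1 - ℓ.ω)⁻¹) * θ.γ := by ring

/-- ★★ **THE CORNER NUMBERS OF THE β OF RECORD CONVERGE GEOMETRICALLY, BY THE KERNEL ROAD** (+ (D4)'s (5.10) clause of record `KernelDecayOfRecord₁₃ F N θ 0 1 ℓ.κ`, §2b (iii)'s `hdec`,
`0 < ℓ.κ`): with the corner kernels of record as above, `betaOfRecord₁₃ F N θ k (t,…,t) → secondMoment (Π⁰_k) 0 1` (so FILE 2's corner numbers of the β of record ARE these second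
moments), the corner-number step is `≤ ℓ.C₅·ℓ.θ₅^{k+1}·betaPrime510 4 1 ℓ.κ`, and `|secondMoment (Π⁰_k) 0 1 − secondMoment (Π⁰_∞) 0 1| ≤ ℓ.C₅·ℓ.θ₅^{k+1}∕(1−ℓ.θ₅)·betaPrime510 4 1 ℓ.κ`.
LOCATED: the three kernel letters displayed (N18 ∕ N22 ∕ (D4) content); nothing of Bałaban asserted; K2⁷'s identification ∕ sign NOT claimed.
[cite: Balaban1987RG1, Thm 1 p.259, (1.22) p.264, (2.12)-(2.14) p.268 and (5.10) p.293] -/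
theorem cornerNumbers_record_geometric_of_kernelLetters (θ : Stage13Params F N) (ℓ : U3Letters₁₁) (hs : ℓ.Signs) (hγ : 0 < θ.γ) (hκ : 0 < ℓ.κ)
    (h9 : NE9 ((objectsOfRecord₁₃ F N θ ℓ).EA 0) (Window θ.γ) ℓ.κ ℓ.moduli) (hdec : KernelDecayOfRecord₁₃ F N θ 0 1 ℓ.κ)
    (h18 : KernelStepRateOfRecord₁₃ F N θ ℓ.κ ℓ.θ₅ ℓ.C₅) :
    ∃ (c : ℕ → ℝ) (cinf : ℝ),
      (∀ k : ℕ, Tendsto (fun t : ℝ => betaOfRecord₁₃ F N θ k (fun _ : Fin (k + 1) => t)) (𝓝[>] (0 : ℝ)) (𝓝 (c k))) ∧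
      (∀ k : ℕ, |c k - c (k + 1)| ≤ ℓ.C₅ * ℓ.θ₅ ^ (k + 1) * betaPrime510 4 1 ℓ.κ) ∧
      ∀ k : ℕ, |c k - cinf| ≤ ℓ.C₅ * ℓ.θ₅ ^ (k + 1) / (1 - ℓ.θ₅) * betaPrime510 4 1 ℓ.κ := by
  letI := θ.instVβ₁; letI := θ.instVβ₂; letI := θ.instιβ
  obtain ⟨P0, hT, hband⟩ := exists_cornerKernels_of_ne9 F _ θ.ρ8 θ.bV hγ h9
  have hstep := abs_cornerKernel_step_le_of_kernelStepRate F _ θ.ρ8 θ.bV hγ h18 hT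
  obtain ⟨Pinf, hinf⟩ := exists_limitKernel_of_cornerStep hs.θ₅_lt_one hstep
  refine ⟨fun k => secondMoment (P0 k) 0 1, secondMoment Pinf 0 1, fun k => ?_, fun k => ?_, fun k => ?_⟩
  · -- on the box the β of record IS the merged β (`betaOfMerged_of_mem`), and the diagonal lies in the box near `0⁺`
    have h := tendsto_betaMerged_diag_secondMoment_cornerKernel F _ θ.ρ8 θ.bV hγ hκ hdec hband k
    refine h.congr' ?_
    filter_upwards [Ioc_mem_nhdsGT hγ] with t ht
    exact (Node00.betaOfMerged_of_mem _ _ _ (const_mem_box ht)).symm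
  · exact abs_cornerMoment_step_le_of_kernelStepRate F _ θ.ρ8 θ.bV hγ hκ hdec h18 hT hband k
  · exact abs_cornerMoment_sub_limitMoment_le F _ θ.ρ8 θ.bV hγ hκ hdec hband (fun k z => (hinf 0 1 z).2 k) k

end Record

end YMDAG.N18.CornerKernelsOfKernelLetters

end
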